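import Summits.FinalStateConjecture.FinalStateConjecture.Theses.LeakageWritesInInk

/-!
# Birth skeleton of `ProfileTailDecay` (stmt-FinalStateConjecture-18240) — layer-2 child of `LeakageTimeAnalyticity`, route LeakageWritesInInk

Two POINTWISE stubs about the pinned temporal Littlewood–Paley pieces `P_ν G = fun y ↦ ∫ ν φ(ντ) • G (y + τ ∂₀) dτ`
on `Kerr.region a r₀` (no `sSup` in them): `stub_uniformPieceBound` (every derivative of order `≤ k` of every piece,
all real `ν`, is bounded by one `M`) and `stub_decayPieceBound` (for `ν ≥ 1` they are `≤ C'/ν^K`, every `K`); the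
composition PROVES the `sSup` bookkeeping of the canonical tail profile (`Real.sSup_nonneg`, `Real.sSup_le`: empty or
unbounded index sets are harmless because the bounds are pointwise).

Shape (as in `Cruxes/BandFromNonradiation/Lines/birth.lean`): statement defs, sorried stubs `stub_*`, name-keyed aliases
`__Registered.stub_*` (abbrevs), the REAL composition `ProfileTailDecay_of : __Registered.stub_… → … → ProfileTailDecay` (conclusion = the
route decl by name), and a wiring `example`.
-/

set_option linter.dupNamespace false

namespace Summit.FinalStateConjecture.FinalStateConjecture.Cruxes.ProfileTailDecay.Birth

open scoped BigOperators Topology Manifold Classical MeasureTheory ProbabilityTheory Matrix InnerProductSpace ComplexConjugate ContinuousMap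
open Filter Set Function TopologicalSpace MeasureTheory
open Summit.FinalStateConjecture.FinalStateConjecture.Theses.LeakageWritesInInk

/-! ## Statements -/

/-- uniform bound on all derivatives of order `≤ k` of all temporal pieces (classical: `‖ν φ(ν·)‖₁ = ‖φ‖₁`, differentiation under the Bochner integral, the uniform `C^k` bounds of X's class). -/
def UniformPieceBound : Prop :=
  open Literature.Geometry.Lorentzian in ∀ (a r₀ : ℝ) (G : E4 → E4 →L[ℝ] E4 →L[ℝ] ℝ), (0 < r₀ ∧ MetricCoord.IsMetricOn G (Kerr.region a r₀ : Set E4) ∧ (∃ c₀ δ : ℝ, 0 < c₀ ∧ 0 < δ ∧ ∀ x ∈ Kerr.region a r₀, (E4.dx 0) (MetricCoord.sharpAt G x (E4.dx 0)) ≤ -c₀ ∧ (Kerr.radius a x < r₀ + δ → (fderiv ℝ (Kerr.radius a) x) (MetricCoord.sharpAt G x (fderiv ℝ (Kerr.radius a) x)) ≤ -c₀ ∧ c₀ ≤ (E4.dx 0) (MetricCoord.sharpAt G x (fderiv ℝ (Kerr.radius a) x)))) ∧ (∀ x ∈ Kerr.region a r₀, MetricCoord.ricAt G x = 0) ∧ (∀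 x ∈ Kerr.region a r₀, ∑ β : Fin 4, MetricCoord.chrAt G x (MetricCoord.sharpAt G x (E4.dx β)) (E4.basisVector β) = 0) ∧ (∀ k : ℕ, ∃ C : ℝ, ∀ x ∈ Kerr.region a r₀, ‖iteratedFDeriv ℝ k G x‖ ≤ C ∧ ‖MetricCoord.sharpAt G x‖ ≤ C) ∧ (∃ C : ℝ, ∀ x ∈ Kerr.region a r₀, ‖G x - Minkowski.bilin‖ ≤ C / E4.spatialNorm x ∧ ‖iteratedFDeriv ℝ 1 G x‖ ≤ C / E4.spatialNorm x ^ 2 ∧ ‖iteratedFDeriv ℝ 2 G x‖ ≤ C / E4.spatialNorm x ^ 3)) → ∀ k : ℕ, ∃ M : ℝ, 0 < M ∧ ∀ (ν : ℝ) (m : ℕ), m ≤ k → ∀ x ∈ Kerr.region a r₀, ‖iteratedFDeriv ℝ m (fun y : E4 => ∫ τ : ℝ, (ν * (∫ ξ : ℝ, Real.cos (2 * Real.pi * ξ * (ν * τ)) * (Real.smoothTransition (2 - ξ ^ 2) - Real.smoothTransition (2 - (2 * ξ) ^ 2)))) • G (y + τ • E4.basisVector 0)) x‖ ≤ M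

/-- rapid decay in `ν ≥ 1` of all derivatives of order `≤ k` of the pieces (classical: `χ` vanishes near `0`, so `φ = ψ_K^(K)` with `ψ_K` Schwartz; integrate by parts `K` times along `∂₀`). -/
def DecayPieceBound : Prop :=
  open Literature.Geometry.Lorentzian in ∀ (a r₀ : ℝ) (G : E4 → E4 →L[ℝ] E4 →L[ℝ] ℝ), (0 < r₀ ∧ MetricCoord.IsMetricOn G (Kerr.region a r₀ : Set E4) ∧ (∃ c₀ δ : ℝ, 0 < c₀ ∧ 0 < δ ∧ ∀ x ∈ Kerr.region a r₀, (E4.dx 0) (MetricCoord.sharpAt G x (E4.dx 0)) ≤ -c₀ ∧ (Kerr.radius a x < r₀ + δ → (fderiv ℝ (Kerr.radius a) x) (MetricCoord.sharpAt G x (fderiv ℝ (Kerr.radius a) x)) ≤ -c₀ ∧ c₀ ≤ (E4.dx 0) (MetricCoord.sharpAt G x (fderiv ℝ (Kerr.radius a) x)))) ∧ (∀ x ∈ Kerr.region a r₀, MetricCoord.ricAt G x = 0) ∧ (∀ x ∈ Kerr.region a r₀, ∑ β : Fin 4, MetricCoord.chrAt G x (MetricCoord.sharpAt G x (E4.dx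 β)) (E4.basisVector β) = 0) ∧ (∀ k : ℕ, ∃ C : ℝ, ∀ x ∈ Kerr.region a r₀, ‖iteratedFDeriv ℝ k G x‖ ≤ C ∧ ‖MetricCoord.sharpAt G x‖ ≤ C) ∧ (∃ C : ℝ, ∀ x ∈ Kerr.region a r₀, ‖G x - Minkowski.bilin‖ ≤ C / E4.spatialNorm x ∧ ‖iteratedFDeriv ℝ 1 G x‖ ≤ C / E4.spatialNorm x ^ 2 ∧ ‖iteratedFDeriv ℝ 2 G x‖ ≤ C / E4.spatialNorm x ^ 3)) → ∀ k K : ℕ, ∃ C' : ℝ, 0 ≤ C' ∧ ∀ ν : ℝ, 1 ≤ ν → ∀ m : ℕ, m ≤ k → ∀ x ∈ Kerr.region a r₀, ‖iteratedFDeriv ℝ m (fun y : E4 => ∫ τ : ℝ, (ν * (∫ ξ : ℝ, Real.cos (2 * Real.pi * ξ * (ν * τ)) * (Real.smoothTransition (2 - ξ ^ 2) - Real.smoothTransition (2 - (2 * ξ) ^ 2)))) • G (y + τ • E4.basisVector 0)) x‖ ≤ C' / ν ^ K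

/-! ## Stubs (the only `sorry`s) -/

/-- stub `stub_uniformPieceBound` : `UniformPieceBound` (the only sorries of the file are the stubs). -/
theorem stub_uniformPieceBound : UniformPieceBound := by
  sorry

/-- stub `stub_decayPieceBound` : `DecayPieceBound` (the only sorries of the file are the stubs). -/
theorem stub_decayPieceBound : DecayPieceBound := by
  sorry

namespace __Registered

/-- Alias of `UniformPieceBound` keyed by the registered stub name. -/
abbrev stub_uniformPieceBound : Prop := UniformPieceBound
/-- Alias of `DecayPieceBound` keyed by the registered stub name. -/
abbrev stub_decayPieceBound : Prop := DecayPieceBound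

end __Registered

/-- **Composition** (real proof, no sorry). -/
theorem ProfileTailDecay_of :
    __Registered.stub_uniformPieceBound → __Registered.stub_decayPieceBound →
      Summit.FinalStateConjecture.FinalStateConjecture.Theses.LeakageWritesInInk.ProfileTailDecay := by
  intro h1 h2 a r₀ G hG prof hprof k
  subst hprof
  dsimp only
  refine ⟨?_, ?_⟩
  · obtain ⟨M, hM, hb⟩ := h1 a r₀ G hG k
    refine ⟨M, hM, fun lam => ⟨?_, ?_⟩⟩
    · apply Real.sSup_nonneg
      rintro q ⟨ν, hν, m, hm, x, hx, rfl⟩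
      exact norm_nonneg _
    · apply Real.sSup_le _ hM.le
      rintro q ⟨ν, hν, m, hm, x, hx, rfl⟩
      exact hb ν m hm x hx
  · intro K
    obtain ⟨C', hC', hd⟩ := h2 a r₀ G hG k K
    refine ⟨C', fun lam hlam => ?_⟩
    have hlam0 : 0 < lam := by linarith
    apply Real.sSup_le _ (by positivity)
    rintro q ⟨ν, hν, m, hm, x, hx, rfl⟩
    have hν1 : 1 ≤ ν := le_trans hlam hν
    calc _ ≤ C' / ν ^ K := hd ν hν1 m hm x hx
      _ ≤ C' / lam ^ K :=
          div_le_div_of_nonneg_left hC' (by positivity) (pow_le_pow_left₀ hlam0.le hν K)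

/-- WIRING CHECK (an `example`: no pre-composed witness enters the environment). -/
example : Summit.FinalStateConjecture.FinalStateConjecture.Theses.LeakageWritesInInk.ProfileTailDecay :=
  ProfileTailDecay_of stub_uniformPieceBound stub_decayPieceBound

end Summit.FinalStateConjecture.FinalStateConjecture.Cruxes.ProfileTailDecay.Birth
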